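import Summits.ResolutionOfSingularities.ResolutionOfSingularities.Theorems.MarkedTransferCampaignW46PlaneInvariant
import Summits.ResolutionOfSingularities.ResolutionOfSingularities.Theorems.MarkedTransferCampaignW46LiteralCentreProcrastination
import Literature.AlgebraicGeometry.Hironaka2017.ARSchemeSingGluing
import HarnessLib

/-!
# [OURS · L1 W4.6 rung (i-f)] THE HONEST STEP EXISTS: from every unresolved state whose singular curves are regular there
# is a §2.1-permissible step that does NOT procrastinate (cell res-hironaka, LADDER-RESOLUTION rung L, D-0089; campaign s46,
# prover res-L1-s46-pv-1; host route MarkedTransfer, `--supports stmt-ResolutionOfSingularities-16155`)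

HONEST FRAMING. Nothing here is a statement of H. Hironaka's manuscript (2017-03-23, [Hironaka2017]) and nothing here
asserts that any statement of it holds. Everything is OURS or tree geometry. AI-written; weaker than expert review. No
`sorry`; axioms standard.

## Why (complement to rungs (i-b)/(i-c)/(i-d))

Rung (i-b) says non-procrastinating §2.1-permissible sequences on surfaces are finite; it does not say they RESOLVE — a
sequence may simply have no admissible continuation (e.g. when `Sing(E)` is a singular curve: every point centre on it
procrastinates and the curve itself is not a permissible centre). This file proves the existence half of «the honest
procedure never stalls» in the class where it is true: over a perfect field, if `Sing(E) ≠ ∅` and every CURVE of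
`Sing(E)` (closure of a non-closed singular point) is a regular subscheme, then a non-procrastinating permissible step
exists — blow up such a curve if there is one, otherwise `Sing(E)` consists of closed points only and any of them is a
non-procrastinating centre. Valid in every dimension for the dichotomy as stated (a «curve» here is the closure of any
non-closed point of `Sing(E)`).

## Contents

* `exists_ambientBlowup` — the blowing up of an ambient datum along a proper closed `D` with regular reduced structure is an
  ambient datum over the same (perfect) field, of no larger dimension, and carries standard exponents to standard ones.
* `isPermissibleCentre_closure_of_isRegular` — the closure of a non-closed point of `Sing(E)` with regular reduced structure
  is a §2.1-permissible centre that does not procrastinate; `isPermissibleCentre_singleton_of_forall_isClosed` — if all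
  singular points are closed, each is a non-procrastinating permissible centre.
* **`exists_honestStep`** — RUNG (i-f): the non-procrastinating permissible step exists (perfect `K`, `E` standard,
  `Sing(E) ≠ ∅`, singular curves regular).

## References

* companion modules: `…LiteralCentreProcrastination` (p472353: ambient geometry), `…PlaneInvariant` (p529691:
  `CentreProcrastinates`), `Hironaka2017.ARSchemeSingGluing` (`AmbientDatum.isClosed_sing`).
* H. Hironaka, ms. 2017-03-23, §2.1 p.4 l.34–39 — scope only, under adjudication, not cited as fact. [Hironaka2017]
-/

noncomputable section

set_option linter.dupNamespace false -- mandated namespace of this single-conjunct summit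

open CategoryTheory AlgebraicGeometry TopologicalSpace

namespace Summit.ResolutionOfSingularities.ResolutionOfSingularities.Theorems

namespace CampaignW46

open Literature.AlgebraicGeometry.Resolution
open Literature.AlgebraicGeometry.Hironaka2017.S02Preliminaries
open Literature.AlgebraicGeometry.Hironaka2017.Datum
open Scheme.IdealSheafData

universe u

variable {p : ℕ} [Fact p.Prime] {K : Type u} [Field K] [CharP K p]

/-! ## Blowing up an ambient datum along a regular proper closed subset -/

/-- **The blow-up of an ambient datum along a proper closed subset with regular reduced structure is an ambient datum**
over the same perfect field (irreducible, smooth = regular + perfect, quasi-compact = proper over `Z`), of no larger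
dimension; the transform of a standard ideal exponent is standard (`J′ ⊇ J𝒪_{Z′} ≠ 0`). [cite: Liu2002, Thm. 8.1.19 (a)] -/
theorem exists_ambientBlowup [PerfectField K] (A : AmbientDatum p K) (D : Closeds A.Z)
    (hreg : Scheme.IsRegular (vanishingIdeal D).subscheme) (hne : (D : Set A.Z) ≠ Set.univ) :
    ∃ (A' : AmbientDatum p K) (π : A'.Z ⟶ A.Z), A'.hom = π ≫ A.hom ∧ IsBlowup π (vanishingIdeal D) ∧
      (∀ E : IdealExponent A.Z, E.IsStandard → (E.transform π D).IsStandard) ∧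
        ∀ d : ℕ, topologicalKrullDim A.Z ≤ (d : WithBot ℕ∞) → topologicalKrullDim A'.Z ≤ (d : WithBot ℕ∞) := by
  haveI := A.smooth
  haveI := A.irreducible
  haveI := A.quasiCompact
  haveI : IsLocallyNoetherian A.Z := ambient_isLocallyNoetherian A
  haveI : IsIntegral A.Z := ambient_isIntegral A
  have hZreg : Scheme.IsRegular A.Z := ambient_isRegular A
  obtain ⟨Z', π, hπ⟩ := exists_isBlowup A.Z (vanishingIdeal D)
  have hDtop : (vanishingIdeal D).support ≠ ⊤ := by
    intro h
    apply hne
    have := congrArg (fun S : Closeds A.Z => (S : Set A.Z)) h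
    simpa [coe_support_vanishingIdeal] using this
  have hDne : vanishingIdeal D ≠ ⊥ := fun h => hDtop (by rw [h, Scheme.IdealSheafData.support_bot])
  haveI : IsIntegral Z' := hπ.isIntegral hDne
  haveI : IsProper π := hπ.isProper
  have hZ'reg : Scheme.IsRegular Z' := hπ.isRegular_of_isRegular_subscheme hZreg hreg
  haveI : Smooth (π ≫ A.hom) := smooth_of_isRegular_of_perfectField _ hZ'reg
  let A' : AmbientDatum p K :=
    { Z := Z', hom := π ≫ A.hom, irreducible := inferInstance, smooth := inferInstance,
      quasiCompact := inferInstance }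
  haveI : IsLocallyNoetherian A'.Z := ambient_isLocallyNoetherian A'
  refine ⟨A', π, rfl, hπ, fun E hE => ⟨?_, hE.2⟩, fun d hd => hπ.topologicalKrullDim_le hd⟩
  intro hbot
  apply hπ.comap_ne_bot hDtop hE.1
  have hle : E.J.comap π ≤ (E.transform π D).J := comap_le_controlledTransform π (vanishingIdeal D) E.J E.b
  rw [hbot] at hle
  exact le_bot_iff.1 hle

/-! ## The two kinds of honest centres -/

/-- A proper closed subset of `Sing(E)`: for a standard `E` the generic point of `Z` is not singular. [folklore] -/
theorem ne_univ_of_subset_sing (A : AmbientDatum p K) {E : IdealExponent A.Z} (hE : E.IsStandard) {S : Set A.Z}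
    (hS : S ⊆ E.sing) : S ≠ Set.univ := by
  haveI := ambient_isIntegral A
  intro h
  have hgen : genericPoint A.Z ∈ E.sing := hS (h ▸ Set.mem_univ _)
  exact not_mem_support_genericPoint hE.1 ((one_le_idealOrder_iff E.J _).mp (le_trans (by exact_mod_cast hE.2) hgen))

/-- **A regular curve of the singular locus is an honest centre.** For a non-closed point `η ∈ Sing(E)` whose closure has
regular reduced structure: `cl{η}` is a §2.1-permissible centre for `E` (irreducible; smooth over the perfect `K`; inside
the closed set `Sing(E)`) and it does not procrastinate (it is not a single point). [folklore] -/
theorem isPermissibleCentre_closure_of_isRegular [PerfectField K] (A : AmbientDatum p K) (E : IdealExponent A.Z)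
    {η : A.Z} (hηS : η ∈ E.sing) (hncl : ¬ IsClosed ({η} : Set A.Z))
    (hreg : Scheme.IsRegular (vanishingIdeal (⟨closure {η}, isClosed_closure⟩ : Closeds A.Z)).subscheme) :
    E.IsPermissibleCentre A.hom ⟨closure {η}, isClosed_closure⟩ ∧
      ¬ CentreProcrastinates E ⟨closure {η}, isClosed_closure⟩ := by
  haveI := A.smooth
  have hsub : closure {η} ⊆ E.sing :=
    (A.isClosed_sing E).closure_subset_iff.mpr (Set.singleton_subset_iff.mpr hηS)
  refine ⟨⟨isIrreducible_singleton.closure, smooth_of_isRegular_of_perfectField _ hreg, hsub⟩, ?_⟩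
  · rintro ⟨ξ, -, hD, -, -, -⟩
    apply hncl
    have hηξ : η ∈ ({ξ} : Set A.Z) := by
      rw [← show closure ({η} : Set A.Z) = {ξ} from hD]; exact subset_closure rfl
    rw [Set.mem_singleton_iff] at hηξ
    subst hηξ
    rw [← show closure ({η} : Set A.Z) = {η} from hD]
    exact isClosed_closure

/-- **If every singular point is closed, each singular point is an honest centre**: `{ξ}` is a §2.1-permissible centre
(regular point; smooth over the perfect `K`) and no other singular point specialises to it. [folklore] -/
theorem isPermissibleCentre_singleton_of_forall_isClosed [PerfectField K] (A : AmbientDatum p K) (E : IdealExponent A.Z)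
    (hcl : ∀ η ∈ E.sing, IsClosed ({η} : Set A.Z)) {ξ : A.Z} (hξS : ξ ∈ E.sing) :
    E.IsPermissibleCentre A.hom ⟨{ξ}, hcl ξ hξS⟩ ∧ ¬ CentreProcrastinates E ⟨{ξ}, hcl ξ hξS⟩ := by
  haveI := A.smooth
  haveI : IsLocallyNoetherian A.Z := ambient_isLocallyNoetherian A
  have hZreg : Scheme.IsRegular A.Z := ambient_isRegular A
  have hreg : Scheme.IsRegular (vanishingIdeal (⟨{ξ}, hcl ξ hξS⟩ : Closeds A.Z)).subscheme :=
    isRegular_subscheme_vanishingIdeal_singleton (hcl ξ hξS)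
  refine ⟨⟨isIrreducible_singleton, smooth_of_isRegular_of_perfectField _ hreg, Set.singleton_subset_iff.2 hξS⟩, ?_⟩
  rintro ⟨ξ₀, η, hD, hηS, hne, hsp⟩
  have hξ₀ : ξ₀ = ξ := by
    have : ξ₀ ∈ ({ξ} : Set A.Z) := by
      rw [show (({ξ} : Set A.Z)) = {ξ₀} from hD]; exact rfl
    exact Set.mem_singleton_iff.mp this
  subst hξ₀
  have hmem : ξ₀ ∈ closure ({η} : Set A.Z) := specializes_iff_mem_closure.mp hsp
  rw [(hcl η hηS).closure_eq, Set.mem_singleton_iff] at hmem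
  exact hne hmem.symm

/-! ## Rung (i-f): the honest step exists -/

/-- [OURS · L1 W4.6 rung (i-f)] NOT a statement of the manuscript. **THE HONEST STEP EXISTS.** Over a perfect field of
characteristic `p`: let `E` be a standard ideal exponent on an ambient datum `A` with `Sing(E) ≠ ∅`, such that the closure
of every non-closed point of `Sing(E)` (every curve of the singular locus, on a surface) has regular reduced structure.
Then there are an ambient datum `A′` over the same field, a §2.1-permissible centre `D` for `E` that does NOT
procrastinate, and the blowing up `π : Z′ → Z` along `D` with `A′.hom = π ≫ A.hom`, the transform `E′` standard and
`dim Z′ ≤ dim Z`. With rung (i-b) (no infinite non-procrastinating sequence on surfaces) this is the existence half of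
«the honest procedure resolves»; the persistence of the regularity hypothesis along honest steps is NOT proved here.
[folklore] -/
theorem exists_honestStep [PerfectField K] (A : AmbientDatum p K) (E : IdealExponent A.Z) (hE : E.IsStandard)
    (hne : E.sing.Nonempty)
    (hreg : ∀ η ∈ E.sing, ¬ IsClosed ({η} : Set A.Z) →
      Scheme.IsRegular (vanishingIdeal (⟨closure {η}, isClosed_closure⟩ : Closeds A.Z)).subscheme) :
    ∃ (A' : AmbientDatum p K) (D : Closeds A.Z) (π : A'.Z ⟶ A.Z),
      E.IsPermissibleCentre A.hom D ∧ ¬ CentreProcrastinates E D ∧ A'.hom = π ≫ A.hom ∧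
        IsBlowup π (vanishingIdeal D) ∧ (E.transform π D).IsStandard ∧
          ∀ d : ℕ, topologicalKrullDim A.Z ≤ (d : WithBot ℕ∞) → topologicalKrullDim A'.Z ≤ (d : WithBot ℕ∞) := by
  haveI : IsLocallyNoetherian A.Z := ambient_isLocallyNoetherian A
  by_cases hcurve : ∃ η ∈ E.sing, ¬ IsClosed ({η} : Set A.Z)
  · -- blow up a regular singular curve
    obtain ⟨η, hηS, hncl⟩ := hcurve
    obtain ⟨hD, hnp⟩ := isPermissibleCentre_closure_of_isRegular A E hηS hncl (hreg η hηS hncl)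
    obtain ⟨A', π, hhom, hπ, hst, hdim⟩ := exists_ambientBlowup A ⟨closure {η}, isClosed_closure⟩ (hreg η hηS hncl)
      (ne_univ_of_subset_sing A hE hD.subset_sing)
    exact ⟨A', _, π, hD, hnp, hhom, hπ, hst E hE, hdim⟩
  · -- all singular points are closed: blow up one of them
    push Not at hcurve
    obtain ⟨ξ, hξS⟩ := hne
    obtain ⟨hD, hnp⟩ := isPermissibleCentre_singleton_of_forall_isClosed A E hcurve hξS
    obtain ⟨A', π, hhom, hπ, hst, hdim⟩ := exists_ambientBlowup A ⟨{ξ}, hcurve ξ hξS⟩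
      (isRegular_subscheme_vanishingIdeal_singleton (hcurve ξ hξS)) (ne_univ_of_subset_sing A hE hD.subset_sing)
    exact ⟨A', _, π, hD, hnp, hhom, hπ, hst E hE, hdim⟩

end CampaignW46

end Summit.ResolutionOfSingularities.ResolutionOfSingularities.Theorems

end
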